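import Mathlib
import Literature.Analysis.FluidPDE.VectorCalculus
import Literature.Analysis.FluidPDE.TaoAveragedNondegeneracy
import Summits.NavierStokesRegularity.NavierStokesRegularity.Theorems.SkeletonEquilibrium.Negative.StrainIdentity

/-!
# The quantitative strain identity along a filament of a skeleton equilibrium

Tools stub `stub_slopeFormula` of line `zero-accretion-selection` (crux `SkeletonEquilibrium`,
thesis `FilamentSkeletonRss`, item stmt-NavierStokesRegularity-15400). For a configuration obeying
the per-filament clauses, the integrability clause, the relative-equilibrium system and length
regularity at scales `≥ √Γ` (`Γ ≥ 1`), the slip derivative of filament `j` is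
`w_j′(τ) = ½ + Σ_k (Γγ_k/4π) ∫ (−3)((‖r‖²+1)^(5/2))⁻¹ ⟪r, T_j⟫ ⟪T_k(σ) × r, T_j⟫ dσ`,
`r = Ξ_j(τ) − Ξ_k(σ)`, `T_j = Ξ_j′(τ)`, with Bochner-integrable scalar integrand.

Proof: the landed `witness_slope_eq` gives `w_j′ = ½ + ⟪F_j′, T_j⟫` with `F_j` the induced velocity
along the filament; `F_j′(τ)` is computed filament by filament by one-dimensional differentiation
under the integral sign (`hasDerivAt_integral_of_dominated_loc_of_deriv_le`) for the family
`t ↦ ((‖Ξ_j t − Ξ_k σ‖²+1)^(3/2))⁻¹ • Ξ_k′σ × (Ξ_j t − Ξ_k σ)` on `|t − τ| < 1`: its `t`-derivative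
has norm `≤ 4 (‖Ξ_j t − Ξ_k σ‖²+1)⁻¹ ≤ 12 (‖Ξ_j τ − Ξ_k σ‖²+1)⁻¹` (unit speed), and the latter is
integrable in `σ` by length regularity (dyadic shells `2ⁿ√Γ ≤ ‖Ξ_k σ − Ξ_j τ‖ < 2ⁿ⁺¹√Γ` have
measure `≤ C₀ 2ⁿ⁺¹ √Γ` and carry the integrand `≤ 4⁻ⁿ`). Pairing with `T_j` kills the `T_k × T_j`
term (`⟪T_j, T_k × T_j⟫ = 0`). Kernel calculus adapted from the landed
`…BiotSavartDirectionalDeriv.lean` (p136890).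
-/

noncomputable section

open MeasureTheory Filter Topology Literature.Analysis.FluidPDE Literature.Analysis.FluidPDE.Tao2016
open scoped RealInnerProductSpace InnerProductSpace BigOperators

namespace Summit.NavierStokesRegularity.NavierStokesRegularity.Theorems.SkeletonEquilibrium.ZeroAccretionSelection
set_option linter.dupNamespace false

/-- `‖a × b‖ ≤ ‖a‖ ‖b‖` (from `norm_cross`, `sin ≤ 1`). [folklore] -/
private theorem ssf_norm_cross_le (a b : EuclideanSpace ℝ (Fin 3)) :
    ‖cross a b‖ ≤ ‖a‖ * ‖b‖ := by
  rw [norm_cross]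
  exact mul_le_of_le_one_right (by positivity) (Real.sin_le_one _)

/-- Chain rule for the regularised kernel along a curve `p` with velocity `v` at `s`:
`d/ds ((‖p s‖² + 1)^{3/2})⁻¹ = −3 ⟪p s, v⟫ ((‖p s‖² + 1)^{5/2})⁻¹`. [folklore] -/
private theorem ssf_hasDerivAt_kernel {p : ℝ → EuclideanSpace ℝ (Fin 3)}
    {v : EuclideanSpace ℝ (Fin 3)} {s : ℝ} (hp : HasDerivAt p v s) :
    HasDerivAt (fun s : ℝ => ((‖p s‖ ^ 2 + 1) ^ (3 / 2 : ℝ))⁻¹)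
      (-3 * ⟪p s, v⟫ * ((‖p s‖ ^ 2 + 1) ^ (5 / 2 : ℝ))⁻¹) s := by
  have hpos : ∀ z : EuclideanSpace ℝ (Fin 3), 0 < ‖z‖ ^ 2 + 1 := fun z => by positivity
  have h1 : HasDerivAt (fun s : ℝ => ‖p s‖ ^ 2 + 1) (2 * ⟪p s, v⟫) s := hp.norm_sq.add_const _
  have h2 := h1.rpow_const (p := -(3 / 2)) (Or.inl (hpos _).ne')
  have hfun : (fun s : ℝ => ((‖p s‖ ^ 2 + 1) ^ (3 / 2 : ℝ))⁻¹)
      = fun s => (‖p s‖ ^ 2 + 1) ^ (-(3 / 2) : ℝ) := by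
    funext s
    rw [Real.rpow_neg (hpos _).le]
  rw [hfun]
  refine h2.congr_deriv ?_
  rw [show (-(3 / 2) : ℝ) - 1 = -(5 / 2) by norm_num, Real.rpow_neg (hpos _).le]
  ring

/-- Product rule along a curve `p` with velocity `v`: the `s`-derivative of the regularised
Biot–Savart integrand `((‖p s‖² + 1)^{3/2})⁻¹ • a × p s` is
`(−3 ⟪p s, v⟫ ((‖p s‖² + 1)^{5/2})⁻¹) • a × p s + ((‖p s‖² + 1)^{3/2})⁻¹ • a × v`. [folklore] -/
private theorem ssf_hasDerivAt_integrand {p : ℝ → EuclideanSpace ℝ (Fin 3)}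
    {v : EuclideanSpace ℝ (Fin 3)} (a : EuclideanSpace ℝ (Fin 3)) {s : ℝ} (hp : HasDerivAt p v s) :
    HasDerivAt (fun s : ℝ => ((‖p s‖ ^ 2 + 1) ^ (3 / 2 : ℝ))⁻¹ • cross a (p s))
      ((-3 * ⟪p s, v⟫ * ((‖p s‖ ^ 2 + 1) ^ (5 / 2 : ℝ))⁻¹) • cross a (p s) +
        ((‖p s‖ ^ 2 + 1) ^ (3 / 2 : ℝ))⁻¹ • cross a v) s := by
  have hc : HasDerivAt (fun s : ℝ => cross a (p s)) (cross a v) s := by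
    have h := (crossCLM a).hasFDerivAt.comp_hasDerivAt s hp
    simpa [Function.comp_def] using h
  exact ((ssf_hasDerivAt_kernel hp).smul hc).congr_deriv (add_comm _ _)

/-- Pointwise bound on the derivative integrand (core `1`, `‖a‖ ≤ 1`):
`‖(−3 ⟪w, v⟫ K₅(w)) • a × w + K₃(w) • a × v‖ ≤ 4 (‖w‖² + 1)⁻¹ ‖v‖`
(`|⟪w, v⟫| ‖a × w‖ ≤ ‖v‖ ‖w‖² ≤ ‖v‖ σ`, `σ = ‖w‖² + 1 ≥ 1`, `σ^{−3/2} ≤ σ⁻¹`). [folklore] -/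
private theorem ssf_norm_deriv_integrand_le (a w v : EuclideanSpace ℝ (Fin 3)) (ha : ‖a‖ ≤ 1) :
    ‖(-3 * ⟪w, v⟫ * ((‖w‖ ^ 2 + 1) ^ (5 / 2 : ℝ))⁻¹) • cross a w +
        ((‖w‖ ^ 2 + 1) ^ (3 / 2 : ℝ))⁻¹ • cross a v‖ ≤ 4 * (‖w‖ ^ 2 + 1)⁻¹ * ‖v‖ := by
  set σ := ‖w‖ ^ 2 + 1 with hσ_def
  have hσ1 : 1 ≤ σ := le_add_of_nonneg_left (sq_nonneg _)
  have hσ0 : 0 < σ := one_pos.trans_le hσ1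
  have hwσ : ‖w‖ ^ 2 ≤ σ := le_add_of_nonneg_right zero_le_one
  have hk3 : (σ ^ (3 / 2 : ℝ))⁻¹ = σ ^ (-(3 / 2) : ℝ) := (Real.rpow_neg hσ0.le _).symm
  have hk5 : (σ ^ (5 / 2 : ℝ))⁻¹ = σ ^ (-(5 / 2) : ℝ) := (Real.rpow_neg hσ0.le _).symm
  have hcw : ‖cross a w‖ ≤ ‖w‖ :=
    (ssf_norm_cross_le a w).trans (mul_le_of_le_one_left (norm_nonneg _) ha)
  have hcv : ‖cross a v‖ ≤ ‖v‖ :=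
    (ssf_norm_cross_le a v).trans (mul_le_of_le_one_left (norm_nonneg _) ha)
  have hi : |⟪w, v⟫| ≤ ‖w‖ * ‖v‖ := abs_real_inner_le_norm w v
  have h32 : σ ^ (-(3 / 2) : ℝ) ≤ σ⁻¹ := by
    rw [show (-(3 / 2) : ℝ) = -(1 / 2) + -1 by norm_num, Real.rpow_add hσ0, Real.rpow_neg_one]
    exact mul_le_of_le_one_left (inv_nonneg.2 hσ0.le)
      (Real.rpow_le_one_of_one_le_of_nonpos hσ1 (by norm_num))
  have h1 : ‖(-3 * ⟪w, v⟫ * (σ ^ (5 / 2 : ℝ))⁻¹) • cross a w‖ ≤ 3 * σ ^ (-(3 / 2) : ℝ) * ‖v‖ := by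
    rw [norm_smul, hk5, Real.norm_eq_abs, abs_mul, abs_mul, abs_neg,
      abs_of_pos (by norm_num : (0 : ℝ) < 3), abs_of_nonneg (Real.rpow_nonneg hσ0.le _)]
    calc 3 * |⟪w, v⟫| * σ ^ (-(5 / 2) : ℝ) * ‖cross a w‖
        ≤ 3 * (‖w‖ * ‖v‖) * σ ^ (-(5 / 2) : ℝ) * ‖w‖ :=
          mul_le_mul (by gcongr) hcw (norm_nonneg _) (by positivity)
      _ = 3 * (σ ^ (-(5 / 2) : ℝ) * ‖w‖ ^ 2) * ‖v‖ := by ring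
      _ ≤ 3 * (σ ^ (-(5 / 2) : ℝ) * σ) * ‖v‖ := by gcongr
      _ = 3 * σ ^ (-(3 / 2) : ℝ) * ‖v‖ := by
          rw [show (-(3 / 2) : ℝ) = -(5 / 2) + 1 by norm_num, Real.rpow_add_one hσ0.ne']
  have h2 : ‖(σ ^ (3 / 2 : ℝ))⁻¹ • cross a v‖ ≤ σ ^ (-(3 / 2) : ℝ) * ‖v‖ := by
    rw [norm_smul, hk3, Real.norm_of_nonneg (Real.rpow_nonneg hσ0.le _)]
    exact mul_le_mul_of_nonneg_left hcv (Real.rpow_nonneg hσ0.le _)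
  calc _ ≤ _ := norm_add_le _ _
    _ ≤ 3 * σ ^ (-(3 / 2) : ℝ) * ‖v‖ + σ ^ (-(3 / 2) : ℝ) * ‖v‖ := add_le_add h1 h2
    _ = 4 * σ ^ (-(3 / 2) : ℝ) * ‖v‖ := by ring
    _ ≤ 4 * σ⁻¹ * ‖v‖ := by gcongr

/-- Moving the base point within the unit ball costs a factor `3`:
`(‖x − b‖² + 1)⁻¹ ≤ 3 (‖x₁ − b‖² + 1)⁻¹` whenever `‖x − x₁‖ ≤ 1`. [folklore] -/
private theorem ssf_inv_le (b : EuclideanSpace ℝ (Fin 3)) {x x₁ : EuclideanSpace ℝ (Fin 3)}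
    (h : ‖x - x₁‖ ≤ 1) : (‖x - b‖ ^ 2 + 1)⁻¹ ≤ 3 * (‖x₁ - b‖ ^ 2 + 1)⁻¹ := by
  have h1 : ‖x₁ - b‖ ≤ 1 + ‖x - b‖ := by
    have h' := norm_sub_le_norm_sub_add_norm_sub x₁ x b
    rw [norm_sub_rev x₁ x] at h'
    linarith
  have h3 : ‖x₁ - b‖ * ‖x₁ - b‖ ≤ (1 + ‖x - b‖) * (1 + ‖x - b‖) :=
    mul_le_mul h1 h1 (norm_nonneg _) (by positivity)
  have h2 : ‖x₁ - b‖ ^ 2 + 1 ≤ 3 * (‖x - b‖ ^ 2 + 1) := by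
    nlinarith [h3, sq_nonneg (1 - ‖x - b‖)]
  calc (‖x - b‖ ^ 2 + 1)⁻¹ ≤ ((‖x₁ - b‖ ^ 2 + 1) / 3)⁻¹ :=
        inv_anti₀ (by positivity) (by linarith)
    _ = 3 * (‖x₁ - b‖ ^ 2 + 1)⁻¹ := by rw [inv_div, div_eq_mul_inv]

/-- Continuity in `u` of the regularised kernels `u ↦ ((‖z − X u‖² + 1)^p)⁻¹`. [folklore] -/
private theorem ssf_continuous_kernel {X : ℝ → EuclideanSpace ℝ (Fin 3)} (hXc : Continuous X)
    (z : EuclideanSpace ℝ (Fin 3)) (p : ℝ) :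
    Continuous (fun u : ℝ => ((‖z - X u‖ ^ 2 + 1) ^ p)⁻¹) := by
  have hpos : ∀ u, (0 : ℝ) < ‖z - X u‖ ^ 2 + 1 := fun u => by positivity
  exact ((((continuous_const.sub hXc).norm.pow 2).add continuous_const).rpow_const
    fun u => Or.inl (hpos u).ne').inv₀ fun u => (Real.rpow_pos_of_pos (hpos u) _).ne'

/-- Continuity in `u` of the integrand `K₃(z − X u) • X′(u) × (z − X u)` at a fixed point `z`
(`X` of class `C¹`). [folklore] -/
private theorem ssf_continuous_integrand {X : ℝ → EuclideanSpace ℝ (Fin 3)} (hX : ContDiff ℝ 1 X)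
    (z : EuclideanSpace ℝ (Fin 3)) :
    Continuous (fun u : ℝ =>
      ((‖z - X u‖ ^ 2 + 1) ^ (3 / 2 : ℝ))⁻¹ • cross (deriv X u) (z - X u)) := by
  have hXc : Continuous X := hX.continuous
  have hX'c : Continuous (deriv X) := hX.continuous_deriv le_rfl
  have hcr : Continuous (fun u => cross (deriv X u) (z - X u)) :=
    (crossCLM.continuous.comp hX'c).clm_apply (continuous_const.sub hXc)
  exact (ssf_continuous_kernel hXc z _).smul hcr

/-- Continuity in `u` of the derivative integrand
`(−3 ⟪z − X u, v⟫ K₅) • X′(u) × (z − X u) + K₃ • X′(u) × v` at a fixed point `z`. [folklore] -/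
private theorem ssf_continuous_deriv_integrand {X : ℝ → EuclideanSpace ℝ (Fin 3)}
    (hX : ContDiff ℝ 1 X) (z v : EuclideanSpace ℝ (Fin 3)) :
    Continuous (fun u : ℝ =>
      (-3 * ⟪z - X u, v⟫ * ((‖z - X u‖ ^ 2 + 1) ^ (5 / 2 : ℝ))⁻¹) • cross (deriv X u) (z - X u) +
        ((‖z - X u‖ ^ 2 + 1) ^ (3 / 2 : ℝ))⁻¹ • cross (deriv X u) v) := by
  have hXc : Continuous X := hX.continuous
  have hX'c : Continuous (deriv X) := hX.continuous_deriv le_rfl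
  have hv : Continuous (fun u : ℝ => z - X u) := continuous_const.sub hXc
  have hcr : Continuous (fun u => cross (deriv X u) (z - X u)) :=
    (crossCLM.continuous.comp hX'c).clm_apply hv
  have hcv : Continuous (fun u => cross (deriv X u) v) :=
    (crossCLM.continuous.comp hX'c).clm_apply continuous_const
  exact (((continuous_const.mul (hv.inner continuous_const)).mul
    (ssf_continuous_kernel hXc z _)).smul hcr).add ((ssf_continuous_kernel hXc z _).smul hcv)

/-- **Integrability from length regularity.** If a continuous curve `X` spends measure `≤ C₀ D`
in every ball of radius `D ≥ D₀` around `x₁` (`D₀ ≥ 1`, `C₀ ≥ 0`), then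
`σ ↦ (‖x₁ − X σ‖² + 1)⁻¹` is integrable: on the dyadic shell `2ⁿD₀ ≤ ‖X σ − x₁‖ < 2ⁿ⁺¹D₀`
(measure `≤ C₀ 2ⁿ⁺¹ D₀`) it is `≤ 4⁻ⁿ`, and on `‖X σ − x₁‖ < D₀` it is `≤ 1`. [folklore] -/
private theorem ssf_integrable_inv {X : ℝ → EuclideanSpace ℝ (Fin 3)} (hXc : Continuous X)
    {D₀ C₀ : ℝ} (hD₀ : 1 ≤ D₀) (hC₀ : 0 ≤ C₀) (x₁ : EuclideanSpace ℝ (Fin 3))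
    (hlen : ∀ D : ℝ, D₀ ≤ D → volume {σ : ℝ | ‖X σ - x₁‖ ≤ D} ≤ ENNReal.ofReal (C₀ * D)) :
    Integrable (fun σ : ℝ => (‖x₁ - X σ‖ ^ 2 + 1)⁻¹) := by
  have hD₀pos : 0 < D₀ := one_pos.trans_le hD₀
  have hpos : ∀ σ, 0 < ‖x₁ - X σ‖ ^ 2 + 1 := fun σ => by positivity
  have hcont : Continuous (fun σ : ℝ => (‖x₁ - X σ‖ ^ 2 + 1)⁻¹) :=
    (((continuous_const.sub hXc).norm.pow 2).add continuous_const).inv₀ fun σ => (hpos σ).ne'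
  have henorm : ∀ σ, ‖(‖x₁ - X σ‖ ^ 2 + 1)⁻¹‖ₑ = ENNReal.ofReal ((‖x₁ - X σ‖ ^ 2 + 1)⁻¹) :=
    fun σ => Real.enorm_eq_ofReal (inv_nonneg.2 (hpos σ).le)
  refine ⟨hcont.aestronglyMeasurable, ?_⟩
  -- the dyadic shells and the inner ball
  set S₀ : Set ℝ := {σ | ‖X σ - x₁‖ < D₀} with hS₀
  set A : ℕ → Set ℝ := fun n => {σ | 2 ^ n * D₀ ≤ ‖X σ - x₁‖ ∧ ‖X σ - x₁‖ < 2 ^ (n + 1) * D₀}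
    with hA
  have hcover : S₀ ∪ ⋃ n, A n = Set.univ := by
    refine Set.eq_univ_of_forall fun σ => ?_
    by_cases h : ‖X σ - x₁‖ < D₀
    · exact Or.inl h
    · obtain ⟨n, hn1, hn2⟩ := exists_nat_pow_near ((one_le_div hD₀pos).mpr (not_lt.mp h)) one_lt_two
      exact Or.inr (Set.mem_iUnion.mpr ⟨n, (le_div_iff₀ hD₀pos).mp hn1, (div_lt_iff₀ hD₀pos).mp hn2⟩)
  -- the inner ball
  have h0 : ∫⁻ σ in S₀, ‖(‖x₁ - X σ‖ ^ 2 + 1)⁻¹‖ₑ ≤ ENNReal.ofReal (C₀ * D₀) := by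
    calc ∫⁻ σ in S₀, ‖(‖x₁ - X σ‖ ^ 2 + 1)⁻¹‖ₑ ≤ ∫⁻ _ in S₀, 1 := lintegral_mono fun σ => by
            rw [henorm σ]
            exact ENNReal.ofReal_le_one.2
              (inv_le_one_of_one_le₀ (le_add_of_nonneg_left (sq_nonneg _)))
      _ = volume S₀ := setLIntegral_one _
      _ ≤ volume {σ : ℝ | ‖X σ - x₁‖ ≤ D₀} :=
          measure_mono fun σ hσ => show ‖X σ - x₁‖ ≤ D₀ from le_of_lt (show ‖X σ - x₁‖ < D₀ from hσ)
      _ ≤ ENNReal.ofReal (C₀ * D₀) := hlen D₀ le_rfl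
  -- the shells
  have h4 : ∀ n : ℕ, (4 : ℝ) ^ n = (2 ^ n) ^ 2 := fun n => by
    rw [← pow_mul, mul_comm, pow_mul]; norm_num
  have hA_int : ∀ n : ℕ, ∫⁻ σ in A n, ‖(‖x₁ - X σ‖ ^ 2 + 1)⁻¹‖ₑ ≤
      ENNReal.ofReal ((4 ^ n)⁻¹ * (C₀ * (2 ^ (n + 1) * D₀))) := by
    intro n
    have hle : D₀ ≤ 2 ^ (n + 1) * D₀ :=
      le_mul_of_one_le_left hD₀pos.le (one_le_pow₀ (by norm_num))
    calc ∫⁻ σ in A n, ‖(‖x₁ - X σ‖ ^ 2 + 1)⁻¹‖ₑ ≤ ∫⁻ _ in A n, ENNReal.ofReal ((4 ^ n)⁻¹) := by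
          refine setLIntegral_mono measurable_const fun σ hσ => ?_
          rw [henorm σ]
          refine ENNReal.ofReal_le_ofReal (inv_anti₀ (by positivity) ?_)
          have h1 : (2 : ℝ) ^ n ≤ 2 ^ n * D₀ := le_mul_of_one_le_right (by positivity) hD₀
          have h2 : ((2 : ℝ) ^ n) ^ 2 ≤ (2 ^ n * D₀) ^ 2 := pow_le_pow_left₀ (by positivity) h1 2
          have h3 : (2 ^ n * D₀) ^ 2 ≤ ‖X σ - x₁‖ ^ 2 := pow_le_pow_left₀ (by positivity) hσ.1 2
          rw [h4, norm_sub_rev]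
          linarith
      _ = ENNReal.ofReal ((4 ^ n)⁻¹) * volume (A n) := setLIntegral_const _ _
      _ ≤ ENNReal.ofReal ((4 ^ n)⁻¹) * ENNReal.ofReal (C₀ * (2 ^ (n + 1) * D₀)) := by
          gcongr
          exact (measure_mono fun σ hσ => hσ.2.le).trans (hlen _ hle)
      _ = ENNReal.ofReal ((4 ^ n)⁻¹ * (C₀ * (2 ^ (n + 1) * D₀))) :=
          (ENNReal.ofReal_mul (by positivity)).symm
  have hsum : Summable fun n : ℕ => ((4 : ℝ) ^ n)⁻¹ * (C₀ * (2 ^ (n + 1) * D₀)) := by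
    refine (summable_geometric_two.mul_left (2 * C₀ * D₀)).congr fun n => ?_
    rw [h4, pow_succ, one_div, inv_pow]
    field_simp
    ring
  have htail : ∫⁻ σ in ⋃ n, A n, ‖(‖x₁ - X σ‖ ^ 2 + 1)⁻¹‖ₑ ≤
      ENNReal.ofReal (∑' n : ℕ, ((4 : ℝ) ^ n)⁻¹ * (C₀ * (2 ^ (n + 1) * D₀))) := by
    calc _ ≤ ∑' n, ∫⁻ σ in A n, ‖(‖x₁ - X σ‖ ^ 2 + 1)⁻¹‖ₑ := lintegral_iUnion_le _ _
      _ ≤ ∑' n : ℕ, ENNReal.ofReal (((4 : ℝ) ^ n)⁻¹ * (C₀ * (2 ^ (n + 1) * D₀))) :=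
          ENNReal.tsum_le_tsum hA_int
      _ = _ := (ENNReal.ofReal_tsum_of_nonneg (fun n => by positivity) hsum).symm
  show ∫⁻ σ, ‖(‖x₁ - X σ‖ ^ 2 + 1)⁻¹‖ₑ < ⊤
  calc ∫⁻ σ, ‖(‖x₁ - X σ‖ ^ 2 + 1)⁻¹‖ₑ
      = ∫⁻ σ in S₀ ∪ ⋃ n, A n, ‖(‖x₁ - X σ‖ ^ 2 + 1)⁻¹‖ₑ := by rw [hcover, Measure.restrict_univ]
    _ ≤ (∫⁻ σ in S₀, ‖(‖x₁ - X σ‖ ^ 2 + 1)⁻¹‖ₑ) + ∫⁻ σ in ⋃ n, A n, ‖(‖x₁ - X σ‖ ^ 2 + 1)⁻¹‖ₑ :=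
        lintegral_union_le _ _ _
    _ < ⊤ := ENNReal.add_lt_top.2
        ⟨h0.trans_lt ENNReal.ofReal_lt_top, htail.trans_lt ENNReal.ofReal_lt_top⟩

/-- **Differentiation under the integral sign along the filament.** For a `C¹` curve `X` with
`‖X′‖ ≤ 1`, a differentiable curve `Y` with `‖Y′‖ ≤ 1`, integrability of the regularised
Biot–Savart integrand of `X` at the point `Y τ` and of `σ ↦ (‖Y τ − X σ‖² + 1)⁻¹`, the induced
velocity `t ↦ ∫ K₃(Y t − X σ) • X′σ × (Y t − X σ) dσ` has at `τ` the derivative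
`∫ [(−3 ⟪Y τ − X σ, Y′τ⟫ K₅) • X′σ × (Y τ − X σ) + K₃ • X′σ × Y′τ] dσ`, with integrable integrand
(dominated on `|t − τ| < 1` by `12 (‖Y τ − X σ‖² + 1)⁻¹`). [folklore] -/
private theorem ssf_key {X Y : ℝ → EuclideanSpace ℝ (Fin 3)} (hX : ContDiff ℝ 1 X)
    (hX1 : ∀ u, ‖deriv X u‖ ≤ 1) (hY : Differentiable ℝ Y) (hY1 : ∀ t, ‖deriv Y t‖ ≤ 1) (τ : ℝ)
    (hint : Integrable (fun σ : ℝ =>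
      ((‖Y τ - X σ‖ ^ 2 + 1) ^ (3 / 2 : ℝ))⁻¹ • cross (deriv X σ) (Y τ - X σ)))
    (hg : Integrable (fun σ : ℝ => (‖Y τ - X σ‖ ^ 2 + 1)⁻¹)) :
    Integrable (fun σ : ℝ =>
        (-3 * ⟪Y τ - X σ, deriv Y τ⟫ * ((‖Y τ - X σ‖ ^ 2 + 1) ^ (5 / 2 : ℝ))⁻¹) •
            cross (deriv X σ) (Y τ - X σ) +
          ((‖Y τ - X σ‖ ^ 2 + 1) ^ (3 / 2 : ℝ))⁻¹ • cross (deriv X σ) (deriv Y τ)) ∧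
      HasDerivAt (fun t : ℝ => ∫ σ : ℝ,
          ((‖Y t - X σ‖ ^ 2 + 1) ^ (3 / 2 : ℝ))⁻¹ • cross (deriv X σ) (Y t - X σ))
        (∫ σ : ℝ,
          (-3 * ⟪Y τ - X σ, deriv Y τ⟫ * ((‖Y τ - X σ‖ ^ 2 + 1) ^ (5 / 2 : ℝ))⁻¹) •
              cross (deriv X σ) (Y τ - X σ) +
            ((‖Y τ - X σ‖ ^ 2 + 1) ^ (3 / 2 : ℝ))⁻¹ • cross (deriv X σ) (deriv Y τ)) τ := by
  have hlip : ∀ t ∈ Metric.ball τ 1, ‖Y t - Y τ‖ ≤ 1 := by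
    intro t ht
    have h := convex_univ.norm_image_sub_le_of_norm_deriv_le (fun x _ => hY x) (fun x _ => hY1 x)
      (Set.mem_univ τ) (Set.mem_univ t)
    rw [one_mul] at h
    exact h.trans (le_of_lt (mem_ball_iff_norm.mp ht))
  refine hasDerivAt_integral_of_dominated_loc_of_deriv_le (𝕜 := ℝ) (μ := volume) (x₀ := τ)
    (F := fun (t : ℝ) (σ : ℝ) =>
      ((‖Y t - X σ‖ ^ 2 + 1) ^ (3 / 2 : ℝ))⁻¹ • cross (deriv X σ) (Y t - X σ))
    (F' := fun (t : ℝ) (σ : ℝ) =>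
      (-3 * ⟪Y t - X σ, deriv Y t⟫ * ((‖Y t - X σ‖ ^ 2 + 1) ^ (5 / 2 : ℝ))⁻¹) •
          cross (deriv X σ) (Y t - X σ) +
        ((‖Y t - X σ‖ ^ 2 + 1) ^ (3 / 2 : ℝ))⁻¹ • cross (deriv X σ) (deriv Y t))
    (bound := fun σ => 12 * (‖Y τ - X σ‖ ^ 2 + 1)⁻¹)
    (Metric.ball_mem_nhds τ one_pos) ?_ hint ?_ ?_ ?_ ?_
  · exact Eventually.of_forall fun t => (ssf_continuous_integrand hX (Y t)).aestronglyMeasurable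
  · exact (ssf_continuous_deriv_integrand hX _ _).aestronglyMeasurable
  · refine Eventually.of_forall fun σ t ht => ?_
    calc _ ≤ 4 * (‖Y t - X σ‖ ^ 2 + 1)⁻¹ * ‖deriv Y t‖ :=
          ssf_norm_deriv_integrand_le _ _ _ (hX1 σ)
      _ ≤ 4 * (3 * (‖Y τ - X σ‖ ^ 2 + 1)⁻¹) * 1 :=
          mul_le_mul (mul_le_mul_of_nonneg_left (ssf_inv_le (X σ) (hlip t ht)) (by norm_num))
            (hY1 t) (norm_nonneg _) (by positivity)
      _ = 12 * (‖Y τ - X σ‖ ^ 2 + 1)⁻¹ := by ring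
  · exact hg.const_mul 12
  · exact Eventually.of_forall fun σ t _ =>
      ssf_hasDerivAt_integrand (deriv X σ) ((hY t).hasDerivAt.sub_const (X σ))

/-- **Tools stub** (`stub_slopeFormula`): THE QUANTITATIVE STRAIN IDENTITY. For a configuration
satisfying the per-filament clauses, the integrability clause, the relative-equilibrium system and
length regularity at scales `≥ √Γ` (`Γ ≥ 1`), the slip derivative of every filament at every
parameter is obtained by differentiating the regularised Biot–Savart integral under the integral
sign along the filament:
`w_j′(τ) = ½ + Σ_k (Γγ_k/4π) ∫ (−3)((‖r‖²+1)^(5/2))⁻¹ ⟪r, T_j⟫ ⟪T_k(σ) × r, T_j⟫ dσ`,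
`r = Ξ_j(τ) − Ξ_k(σ)`, `T_j = Ξ_j′(τ)`, with Bochner-integrable scalar integrand for every `k`
(the `T_k × T_j` term of the derivative is orthogonal to `T_j` and drops out). [folklore] -/
theorem stub_slopeFormula :
    ∀ (N : ℕ) (γ : Fin N → ℝ) (α Γ K C₀ : ℝ), 1 ≤ Γ → 0 < C₀ →
      ∀ (Ξ : Fin N → ℝ → EuclideanSpace ℝ (Fin 3)) (w : Fin N → ℝ → ℝ),
        (∀ j, ContDiff ℝ 2 (Ξ j) ∧ Function.Injective (Ξ j) ∧ Differentiable ℝ (w j) ∧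
            (∀ τ, ‖deriv (Ξ j) τ‖ = 1) ∧ (∀ τ, ‖iteratedDeriv 2 (Ξ j) τ‖ * Real.sqrt Γ ≤ K) ∧
            Tendsto (fun τ => ‖Ξ j τ‖) atTop atTop ∧ Tendsto (fun τ => ‖Ξ j τ‖) atBot atTop) →
        (∀ j (x : EuclideanSpace ℝ (Fin 3)), Integrable (fun σ : ℝ =>
            ((‖x - Ξ j σ‖ ^ 2 + 1) ^ (3 / 2 : ℝ))⁻¹ • cross (deriv (Ξ j) σ) (x - Ξ j σ))) →
        (∀ j τ, (∑ k : Fin N, (Γ * γ k / (4 * Real.pi)) • ∫ σ : ℝ,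
              ((‖Ξ j τ - Ξ k σ‖ ^ 2 + 1) ^ (3 / 2 : ℝ))⁻¹ • cross (deriv (Ξ k) σ) (Ξ j τ - Ξ k σ))
            + (1 / 2 : ℝ) • Ξ j τ - α • cross (EuclideanSpace.single (2 : Fin 3) (1 : ℝ)) (Ξ j τ)
            = w j τ • deriv (Ξ j) τ) →
        (∀ (k : Fin N) (x : EuclideanSpace ℝ (Fin 3)) (D : ℝ), Real.sqrt Γ ≤ D →
            volume {τ : ℝ | ‖Ξ k τ - x‖ ≤ D} ≤ ENNReal.ofReal (C₀ * D)) →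
        ∀ (j : Fin N) (τ : ℝ),
          (∀ k : Fin N, Integrable (fun σ : ℝ =>
            (-3) * ((‖Ξ j τ - Ξ k σ‖ ^ 2 + 1) ^ (5 / 2 : ℝ))⁻¹ * ⟪Ξ j τ - Ξ k σ, deriv (Ξ j) τ⟫ *
              ⟪cross (deriv (Ξ k) σ) (Ξ j τ - Ξ k σ), deriv (Ξ j) τ⟫)) ∧
          deriv (w j) τ = 1 / 2 + ∑ k : Fin N, (Γ * γ k / (4 * Real.pi)) * ∫ σ : ℝ,
            (-3) * ((‖Ξ j τ - Ξ k σ‖ ^ 2 + 1) ^ (5 / 2 : ℝ))⁻¹ * ⟪Ξ j τ - Ξ k σ, deriv (Ξ j) τ⟫ *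
              ⟪cross (deriv (Ξ k) σ) (Ξ j τ - Ξ k σ), deriv (Ξ j) τ⟫ := by
  intro N γ α Γ _K C₀ hΓ hC₀ Ξ w hfil hint heq hlen j τ
  have hC2 : ∀ i, ContDiff ℝ 2 (Ξ i) := fun i => (hfil i).1
  have hunit : ∀ i t, ‖deriv (Ξ i) t‖ = 1 := fun i => (hfil i).2.2.2.1
  have hw : ∀ i, Differentiable ℝ (w i) := fun i => (hfil i).2.2.1
  have hC1 : ∀ i, ContDiff ℝ 1 (Ξ i) := fun i => (hC2 i).of_le one_le_two
  have hdiff : ∀ i, Differentiable ℝ (Ξ i) := fun i => (hC1 i).differentiable one_ne_zero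
  have hD₀ : 1 ≤ Real.sqrt Γ := Real.one_le_sqrt.mpr hΓ
  have key := fun k : Fin N => ssf_key (hC1 k) (fun u => (hunit k u).le) (hdiff j)
    (fun t => (hunit j t).le) τ (hint k (Ξ j τ))
    (ssf_integrable_inv (hC1 k).continuous hD₀ hC₀.le (Ξ j τ) fun D hD => hlen k (Ξ j τ) D hD)
  obtain ⟨_, hslope⟩ :=
    Summit.NavierStokesRegularity.NavierStokesRegularity.Theorems.SkeletonEquilibrium.Negative.witness_slope_eq
      hC2 hunit hw heq j
  have hF : HasDerivAt (fun t => ∑ k : Fin N, (Γ * γ k / (4 * Real.pi)) • ∫ σ : ℝ,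
      ((‖Ξ j t - Ξ k σ‖ ^ 2 + 1) ^ (3 / 2 : ℝ))⁻¹ • cross (deriv (Ξ k) σ) (Ξ j t - Ξ k σ))
      (∑ k : Fin N, (Γ * γ k / (4 * Real.pi)) • ∫ σ : ℝ,
        ((-3 * ⟪Ξ j τ - Ξ k σ, deriv (Ξ j) τ⟫ * ((‖Ξ j τ - Ξ k σ‖ ^ 2 + 1) ^ (5 / 2 : ℝ))⁻¹) •
            cross (deriv (Ξ k) σ) (Ξ j τ - Ξ k σ) +
          ((‖Ξ j τ - Ξ k σ‖ ^ 2 + 1) ^ (3 / 2 : ℝ))⁻¹ • cross (deriv (Ξ k) σ) (deriv (Ξ j) τ))) τ :=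
    HasDerivAt.fun_sum fun k _ => (key k).2.const_smul (Γ * γ k / (4 * Real.pi))
  have hfun : ∀ (k : Fin N) (σ : ℝ),
      ⟪deriv (Ξ j) τ, (-3 * ⟪Ξ j τ - Ξ k σ, deriv (Ξ j) τ⟫ *
            ((‖Ξ j τ - Ξ k σ‖ ^ 2 + 1) ^ (5 / 2 : ℝ))⁻¹) • cross (deriv (Ξ k) σ) (Ξ j τ - Ξ k σ) +
          ((‖Ξ j τ - Ξ k σ‖ ^ 2 + 1) ^ (3 / 2 : ℝ))⁻¹ • cross (deriv (Ξ k) σ) (deriv (Ξ j) τ)⟫ =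
        (-3) * ((‖Ξ j τ - Ξ k σ‖ ^ 2 + 1) ^ (5 / 2 : ℝ))⁻¹ * ⟪Ξ j τ - Ξ k σ, deriv (Ξ j) τ⟫ *
          ⟪cross (deriv (Ξ k) σ) (Ξ j τ - Ξ k σ), deriv (Ξ j) τ⟫ := by
    intro k σ
    rw [inner_add_right, real_inner_smul_right, real_inner_smul_right, inner_self_cross_right,
      mul_zero, add_zero, real_inner_comm (cross (deriv (Ξ k) σ) (Ξ j τ - Ξ k σ))]
    ring
  refine ⟨fun k => ((key k).1.const_inner (deriv (Ξ j) τ)).congr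
    (Eventually.of_forall (hfun k)), ?_⟩
  rw [hslope τ, hF.deriv, sum_inner]
  congr 1
  refine Finset.sum_congr rfl fun k _ => ?_
  rw [real_inner_smul_left]
  congr 1
  calc _ = ⟪deriv (Ξ j) τ, _⟫ := real_inner_comm _ _
    _ = _ := (integral_inner (key k).1 (deriv (Ξ j) τ)).symm
    _ = _ := integral_congr_ae (Eventually.of_forall (hfun k))

end Summit.NavierStokesRegularity.NavierStokesRegularity.Theorems.SkeletonEquilibrium.ZeroAccretionSelection
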